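import Summits.SmoothPoincare4.SmoothPoincare4.Theorems.EntropyRungConicalGapSecondWeightedIdentity
import Literature.Geometry.Riemannian.GradientSolitonIdentities
import HarnessLib

/-!
# Helper `helper_ricciMomentIdentity` of line `Sketch`
(crux `EntropyRung.ConicalGap`, stmt-SmoothPoincare4-16589)

The **Ricci moment identity at every scale**, `n = 4`: on a complete connected normalised gradient
shrinking Ricci soliton `(M⁴, g, f)` (`Ric + Hess f = g/2`, `R + |∇f|² = f`, closed `g`-balls
compact), for every `τ > 0`, writing `v = e^{-f/τ}` and all integrals w.r.t. `dV`,

  `2 ∫ |Ric|² v = ∫ R v + (τ − 1) · [τ⁻² ∫ (f R − R²) v − τ⁻¹ ∫ (2R − R²) v]`,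

GIVEN that `|Ric|² v` and `g⁻¹(dR, df) v` are integrable (hypotheses; at `τ = 1` this is the
classical `2 ∫ |Ric|² e^{-f} = ∫ R e^{-f}`). Ingredients, all theorems of the tree:

* Hamilton's identity `Δ R = g⁻¹(dR, df) + R − 2|Ric|²` (`dalembertian_scalarCurvature_of_soliton`,
  Munteanu–Wang 2016, §2);
* `Δ v = v [τ⁻² (f − R) − τ⁻¹ (n/2 − R)]` (`weightedIdentity_dalembertian_expNegDiv`) and the chain
  rule `g⁻¹(dρ, dv) = −τ⁻¹ v g⁻¹(dρ, df)` (`weightedIdentity_innerDual_mvfderiv_expNegDiv`);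
* Green's first identity along the proper exhaustion `f`
  (`CarrilloNi2009_shrinkerLSI.integral_mul_dalembertian_eq_neg_integral_innerDual_of_proper`),
  applied twice: (A) `u = R`, `w = v`: `∫ R Δv = −∫ g⁻¹(dR, dv) = τ⁻¹ X`,
  `X := ∫ g⁻¹(dR, df) v` (`ricciMoment_greenA`); (B) `u = v`, `w = R`:
  `∫ v ΔR = −∫ g⁻¹(dv, dR) = τ⁻¹ X` (`ricciMoment_greenB`), whence
  `X + ∫ R v − 2 ∫ |Ric|² v = τ⁻¹ X = ∫ R Δv` and the displayed identity;
* the integrability of the weights `R v`, `f R v` (`weightedIntegrability_riemVolume`,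
  `secondWeightedIdentity_integrable`) and `R² v ≤ f R v` (`ricciMoment_integrable_sq`, from
  `0 ≤ R ≤ f`), properness of `f` and `R ≥ 0`
  (`NoncompactShrinkerGapCarrilloNiClauses.scalarCurvature_nonneg_and_isCompact_sublevel`).

Everything here is proved; no definition and no named fact is introduced.

## References

* O. Munteanu, J. Wang, *Structure at infinity for shrinking Ricci solitons*, arXiv:1606.01861,
  §2 (p. 6). [MunteanuWang2016]
* [CarrilloNi2009] J. Carrillo, L. Ni, Comm. Anal. Geom. 17 (2009) 721–753, §4.
* Y. Wang, G. Wang (Wang–Wang 2023), arXiv:2308.06560, Prop. 2.6.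
-/

noncomputable section

-- `Summit.SmoothPoincare4.SmoothPoincare4.…` (summit = problem) trips `dupNamespace` on every decl.
set_option linter.dupNamespace false

open scoped Manifold ContDiff ENNReal NNReal Topology
open MeasureTheory Set Filter
open Literature.Geometry.Lorentzian Literature.Geometry.Riemannian

namespace Summit.SmoothPoincare4.SmoothPoincare4.Theorems.ConicalGapSketch

/-! ## The two Green identities on a proper normalised shrinker (any dimension) -/

section ProperGreen

variable {n : ℕ} {M : Type*} [TopologicalSpace M] [ChartedSpace (EuclideanSpace ℝ (Fin n)) M]
  [IsManifold (𝓡 n) ∞ M] [T3Space M] [MeasurableSpace M] [BorelSpace M]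
  {g : PseudoRiemannianMetric (𝓡 n) ∞ (EuclideanSpace ℝ (Fin n)) (TangentSpace (𝓡 n) : M → Type _)}
  {f : M → ℝ} [g.HasLeviCivita]

/-- **`R² e^{-f/τ}` is integrable for every `τ > 0`** on a gradient shrinker with proper potential and
`R ≥ 0`, over `g.riemVolume`: `0 ≤ R ≤ f` (`R + |∇f|² = f`, `|∇f|² ≥ 0`), so
`0 ≤ R² e^{-f/τ} ≤ f R e^{-f/τ}`, integrable by `secondWeightedIdentity_integrable`. -/
theorem ricciMoment_integrable_sq (hg : g.IsRiemannian) (hf : ContMDiff (𝓡 n) 𝓘(ℝ, ℝ) ∞ f)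
    (hsol : ∀ (x : M) (X Y : TangentSpace (𝓡 n) x),
      g.ricci x X Y + g.hessian f x X Y = (1 / 2 : ℝ) * g.val x X Y)
    (hnorm : ∀ x : M, g.scalarCurvature x + g.gradSq f x = f x)
    (hprop : ∀ R : ℝ, IsCompact {x | f x ≤ R}) (hR0 : ∀ x, 0 ≤ g.scalarCurvature x) {τ : ℝ}
    (hτ : 0 < τ) :
    Integrable (fun x ↦ g.scalarCurvature x ^ 2 * Real.exp (-f x / τ)) g.riemVolume := by
  have hRle : ∀ x, g.scalarCurvature x ≤ f x := fun x ↦ by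
    linarith [hnorm x, g.gradSq_nonneg hg f x]
  obtain ⟨-, iFR⟩ := secondWeightedIdentity_integrable hg hf hsol hnorm hprop hR0 hτ
  have hE : Continuous fun x ↦ Real.exp (-f x / τ) :=
    Real.continuous_exp.comp (hf.continuous.neg.div_const _)
  have hSc : Continuous fun x ↦ g.scalarCurvature x :=
    (PseudoRiemannianMetric.contMDiff_scalarCurvature g).continuous
  refine iFR.mono ((hSc.pow 2).mul hE).aestronglyMeasurable (Eventually.of_forall fun x ↦ ?_)
  rw [Real.norm_eq_abs, Real.norm_eq_abs,
    abs_of_nonneg (mul_nonneg (sq_nonneg _) (Real.exp_pos _).le),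
    abs_of_nonneg (mul_nonneg (mul_nonneg ((hR0 x).trans (hRle x)) (hR0 x)) (Real.exp_pos _).le),
    sq]
  exact mul_le_mul_of_nonneg_right (mul_le_mul_of_nonneg_right (hRle x) (hR0 x))
    (Real.exp_pos _).le

/-- **Green (A): `∫ R Δ(e^{-f/τ}) dV = −∫ g⁻¹(dR, d e^{-f/τ}) dV = τ⁻¹ ∫ g⁻¹(dR, df) e^{-f/τ} dV`**
on a gradient shrinker with proper potential and `R ≥ 0`, GIVEN integrability of
`g⁻¹(dR, df) e^{-f/τ}`, with the left side expanded by
`R Δ(e^{-f/τ}) = τ⁻² (f R − R²) e^{-f/τ} − τ⁻¹ ((n/2) R − R²) e^{-f/τ}`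
(`weightedIdentity_dalembertian_expNegDiv`):
`CarrilloNi2009_shrinkerLSI.integral_mul_dalembertian_eq_neg_integral_innerDual_of_proper` with
`ρ = f`, `u = R`, `w = e^{-f/τ}`, the provisos being the weights `R e^{-f/τ}`, `f R e^{-f/τ}`,
`R² e^{-f/τ}` and `g⁻¹(df, d e^{-f/τ}) = −τ⁻¹ e^{-f/τ} (f − R)`. -/
theorem ricciMoment_greenA (hg : g.IsRiemannian) (hf : ContMDiff (𝓡 n) 𝓘(ℝ, ℝ) ∞ f)
    (hsol : ∀ (x : M) (X Y : TangentSpace (𝓡 n) x),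
      g.ricci x X Y + g.hessian f x X Y = (1 / 2 : ℝ) * g.val x X Y)
    (hnorm : ∀ x : M, g.scalarCurvature x + g.gradSq f x = f x)
    (hprop : ∀ R : ℝ, IsCompact {x | f x ≤ R}) (hR0 : ∀ x, 0 ≤ g.scalarCurvature x) {τ : ℝ}
    (hτ : 0 < τ)
    (hX : Integrable (fun x ↦ g.innerDual x (mvfderiv (𝓡 n) g.scalarCurvature x).toLinearMap
      (mvfderiv (𝓡 n) f x).toLinearMap * Real.exp (-f x / τ)) g.riemVolume) :
    (τ ^ 2)⁻¹ * ((∫ x, f x * g.scalarCurvature x * Real.exp (-f x / τ) ∂g.riemVolume) -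
        (∫ x, g.scalarCurvature x ^ 2 * Real.exp (-f x / τ) ∂g.riemVolume)) -
      τ⁻¹ * ((n / 2 : ℝ) * (∫ x, g.scalarCurvature x * Real.exp (-f x / τ) ∂g.riemVolume) -
        (∫ x, g.scalarCurvature x ^ 2 * Real.exp (-f x / τ) ∂g.riemVolume)) =
      τ⁻¹ * ∫ x, g.innerDual x (mvfderiv (𝓡 n) g.scalarCurvature x).toLinearMap
        (mvfderiv (𝓡 n) f x).toLinearMap * Real.exp (-f x / τ) ∂g.riemVolume := by
  obtain ⟨-, -, iR⟩ := weightedIntegrability_riemVolume hg hf hsol hnorm hprop hR0 hτ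
  obtain ⟨-, iFR⟩ := secondWeightedIdentity_integrable hg hf hsol hnorm hprop hR0 hτ
  have iR2 := ricciMoment_integrable_sq hg hf hsol hnorm hprop hR0 hτ
  have hτ0 : τ ≠ 0 := hτ.ne'
  -- regularity: `R ∈ C¹`, `e^{-f/τ} ∈ C²`
  have hS1 : ContMDiff (𝓡 n) 𝓘(ℝ, ℝ) 1 g.scalarCurvature :=
    (PseudoRiemannianMetric.contMDiff_scalarCurvature g).of_le ENat.LEInfty.out
  have hw : ContMDiff (𝓡 n) 𝓘(ℝ, ℝ) 2 (fun y ↦ Real.exp (-f y / τ)) :=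
    ((Real.contDiff_exp.comp (contDiff_neg.div_const τ)).comp_contMDiff hf).of_le ENat.LEInfty.out
  -- pointwise `R Δ(e^{-f/τ})`
  have hpt : ∀ x, g.scalarCurvature x * g.dalembertian (fun y ↦ Real.exp (-f y / τ)) x =
      (τ ^ 2)⁻¹ * (f x * g.scalarCurvature x * Real.exp (-f x / τ) -
        g.scalarCurvature x ^ 2 * Real.exp (-f x / τ)) -
      τ⁻¹ * ((n / 2 : ℝ) * (g.scalarCurvature x * Real.exp (-f x / τ)) -
        g.scalarCurvature x ^ 2 * Real.exp (-f x / τ)) := fun x ↦ by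
    rw [weightedIdentity_dalembertian_expNegDiv hsol hnorm hf τ x]
    field_simp
    ring
  have iA : Integrable (fun x ↦ (τ ^ 2)⁻¹ * (f x * g.scalarCurvature x * Real.exp (-f x / τ) -
      g.scalarCurvature x ^ 2 * Real.exp (-f x / τ))) g.riemVolume := (iFR.sub iR2).const_mul _
  have iB : Integrable (fun x ↦ τ⁻¹ * ((n / 2 : ℝ) * (g.scalarCurvature x * Real.exp (-f x / τ)) -
      g.scalarCurvature x ^ 2 * Real.exp (-f x / τ))) g.riemVolume :=
    ((iR.const_mul _).sub iR2).const_mul _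
  have huΔ : Integrable (fun x ↦ g.scalarCurvature x *
      g.dalembertian (fun y ↦ Real.exp (-f y / τ)) x) g.riemVolume :=
    (iA.sub iB).congr (Eventually.of_forall fun x ↦ (hpt x).symm)
  -- pointwise `g⁻¹(dR, d e^{-f/τ}) = -τ⁻¹ g⁻¹(dR, df) e^{-f/τ}`
  have hduw_pt : ∀ x, g.innerDual x (mvfderiv (𝓡 n) g.scalarCurvature x).toLinearMap
      (mvfderiv (𝓡 n) (fun y ↦ Real.exp (-f y / τ)) x).toLinearMap =
      -τ⁻¹ * (g.innerDual x (mvfderiv (𝓡 n) g.scalarCurvature x).toLinearMap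
        (mvfderiv (𝓡 n) f x).toLinearMap * Real.exp (-f x / τ)) := fun x ↦ by
    rw [weightedIdentity_innerDual_mvfderiv_expNegDiv τ (hf.mdifferentiableAt (by norm_num))]
    ring
  have hduw : Integrable (fun x ↦ g.innerDual x (mvfderiv (𝓡 n) g.scalarCurvature x).toLinearMap
      (mvfderiv (𝓡 n) (fun y ↦ Real.exp (-f y / τ)) x).toLinearMap) g.riemVolume :=
    (hX.const_mul (-τ⁻¹)).congr (Eventually.of_forall fun x ↦ (hduw_pt x).symm)
  -- pointwise `R g⁻¹(df, d e^{-f/τ}) = -τ⁻¹ (f R − R²) e^{-f/τ}`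
  have hcross_pt : ∀ x, g.scalarCurvature x * g.innerDual x (mvfderiv (𝓡 n) f x).toLinearMap
      (mvfderiv (𝓡 n) (fun y ↦ Real.exp (-f y / τ)) x).toLinearMap =
      -τ⁻¹ * (f x * g.scalarCurvature x * Real.exp (-f x / τ) -
        g.scalarCurvature x ^ 2 * Real.exp (-f x / τ)) := fun x ↦ by
    rw [weightedIdentity_innerDual_mvfderiv_expNegDiv τ (hf.mdifferentiableAt (by norm_num))]
    have hgrad : g.innerDual x (mvfderiv (𝓡 n) f x).toLinearMap (mvfderiv (𝓡 n) f x).toLinearMap =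
        g.gradSq f x := rfl
    rw [hgrad, show g.gradSq f x = f x - g.scalarCurvature x by linarith [hnorm x]]
    ring
  have hcross : Integrable (fun x ↦ g.scalarCurvature x * g.innerDual x
      (mvfderiv (𝓡 n) f x).toLinearMap
      (mvfderiv (𝓡 n) (fun y ↦ Real.exp (-f y / τ)) x).toLinearMap) g.riemVolume :=
    ((iFR.sub iR2).const_mul (-τ⁻¹)).congr (Eventually.of_forall fun x ↦ (hcross_pt x).symm)
  have hG :=
    CarrilloNi2009_shrinkerLSI.integral_mul_dalembertian_eq_neg_integral_innerDual_of_proper hg hf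
      hprop hS1 hw huΔ hduw hcross
  -- evaluate both sides
  have hI1 : ∫ x, g.scalarCurvature x * g.dalembertian (fun y ↦ Real.exp (-f y / τ)) x
      ∂g.riemVolume =
      (τ ^ 2)⁻¹ * ((∫ x, f x * g.scalarCurvature x * Real.exp (-f x / τ) ∂g.riemVolume) -
        (∫ x, g.scalarCurvature x ^ 2 * Real.exp (-f x / τ) ∂g.riemVolume)) -
      τ⁻¹ * ((n / 2 : ℝ) * (∫ x, g.scalarCurvature x * Real.exp (-f x / τ) ∂g.riemVolume) -
        (∫ x, g.scalarCurvature x ^ 2 * Real.exp (-f x / τ) ∂g.riemVolume)) := by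
    simp_rw [hpt]
    rw [integral_sub iA iB, integral_const_mul, integral_const_mul, integral_sub iFR iR2,
      integral_sub (iR.const_mul _) iR2, integral_const_mul]
  have hI2 : ∫ x, g.innerDual x (mvfderiv (𝓡 n) g.scalarCurvature x).toLinearMap
      (mvfderiv (𝓡 n) (fun y ↦ Real.exp (-f y / τ)) x).toLinearMap ∂g.riemVolume =
      -τ⁻¹ * ∫ x, g.innerDual x (mvfderiv (𝓡 n) g.scalarCurvature x).toLinearMap
        (mvfderiv (𝓡 n) f x).toLinearMap * Real.exp (-f x / τ) ∂g.riemVolume := by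
    simp_rw [hduw_pt]
    rw [integral_const_mul]
  rw [hI1, hI2] at hG
  linear_combination hG

/-- **Green (B): `∫ e^{-f/τ} ΔR dV = −∫ g⁻¹(d e^{-f/τ}, dR) dV = τ⁻¹ ∫ g⁻¹(dR, df) e^{-f/τ} dV`**
on a gradient shrinker with proper potential and `R ≥ 0`, GIVEN integrability of `|Ric|² e^{-f/τ}`
and of `g⁻¹(dR, df) e^{-f/τ}`, with the left side expanded by Hamilton's identity
`ΔR = g⁻¹(dR, df) + R − 2|Ric|²` (`dalembertian_scalarCurvature_of_soliton`, `λ = ½`):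
`CarrilloNi2009_shrinkerLSI.integral_mul_dalembertian_eq_neg_integral_innerDual_of_proper` with
`ρ = f`, `u = e^{-f/τ}`, `w = R`, the provisos being the two hypotheses, the weight `R e^{-f/τ}`,
the symmetry of `g⁻¹` (`innerDual_comm`) and the chain rule
`g⁻¹(dR, d e^{-f/τ}) = −τ⁻¹ e^{-f/τ} g⁻¹(dR, df)`. -/
theorem ricciMoment_greenB (hg : g.IsRiemannian) (hf : ContMDiff (𝓡 n) 𝓘(ℝ, ℝ) ∞ f)
    (hsol : ∀ (x : M) (X Y : TangentSpace (𝓡 n) x),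
      g.ricci x X Y + g.hessian f x X Y = (1 / 2 : ℝ) * g.val x X Y)
    (hnorm : ∀ x : M, g.scalarCurvature x + g.gradSq f x = f x)
    (hprop : ∀ R : ℝ, IsCompact {x | f x ≤ R}) (hR0 : ∀ x, 0 ≤ g.scalarCurvature x) {τ : ℝ}
    (hτ : 0 < τ)
    (hRic : Integrable (fun x ↦ g.normSq x (g.ricci x) * Real.exp (-f x / τ)) g.riemVolume)
    (hX : Integrable (fun x ↦ g.innerDual x (mvfderiv (𝓡 n) g.scalarCurvature x).toLinearMap
      (mvfderiv (𝓡 n) f x).toLinearMap * Real.exp (-f x / τ)) g.riemVolume) :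
    (∫ x, g.innerDual x (mvfderiv (𝓡 n) g.scalarCurvature x).toLinearMap
        (mvfderiv (𝓡 n) f x).toLinearMap * Real.exp (-f x / τ) ∂g.riemVolume) +
      (∫ x, g.scalarCurvature x * Real.exp (-f x / τ) ∂g.riemVolume) -
      2 * (∫ x, g.normSq x (g.ricci x) * Real.exp (-f x / τ) ∂g.riemVolume) =
      τ⁻¹ * ∫ x, g.innerDual x (mvfderiv (𝓡 n) g.scalarCurvature x).toLinearMap
        (mvfderiv (𝓡 n) f x).toLinearMap * Real.exp (-f x / τ) ∂g.riemVolume := by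
  obtain ⟨-, -, iR⟩ := weightedIntegrability_riemVolume hg hf hsol hnorm hprop hR0 hτ
  have hτ0 : τ ≠ 0 := hτ.ne'
  -- regularity: `e^{-f/τ} ∈ C¹`, `R ∈ C²`
  have hv1 : ContMDiff (𝓡 n) 𝓘(ℝ, ℝ) 1 (fun y ↦ Real.exp (-f y / τ)) :=
    ((Real.contDiff_exp.comp (contDiff_neg.div_const τ)).comp_contMDiff hf).of_le ENat.LEInfty.out
  have hS2 : ContMDiff (𝓡 n) 𝓘(ℝ, ℝ) 2 g.scalarCurvature :=
    (PseudoRiemannianMetric.contMDiff_scalarCurvature g).of_le ENat.LEInfty.out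
  -- pointwise `e^{-f/τ} ΔR` (Hamilton's identity)
  have hpt : ∀ x, Real.exp (-f x / τ) * g.dalembertian g.scalarCurvature x =
      g.innerDual x (mvfderiv (𝓡 n) g.scalarCurvature x).toLinearMap
        (mvfderiv (𝓡 n) f x).toLinearMap * Real.exp (-f x / τ) +
      g.scalarCurvature x * Real.exp (-f x / τ) -
      2 * (g.normSq x (g.ricci x) * Real.exp (-f x / τ)) := fun x ↦ by
    rw [dalembertian_scalarCurvature_of_soliton g hf hsol x]
    ring
  have iA : Integrable (fun x ↦ g.innerDual x (mvfderiv (𝓡 n) g.scalarCurvature x).toLinearMap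
        (mvfderiv (𝓡 n) f x).toLinearMap * Real.exp (-f x / τ) +
      g.scalarCurvature x * Real.exp (-f x / τ)) g.riemVolume := hX.add iR
  have iC : Integrable (fun x ↦ 2 * (g.normSq x (g.ricci x) * Real.exp (-f x / τ)))
      g.riemVolume := hRic.const_mul 2
  have iB : Integrable (fun x ↦ g.innerDual x (mvfderiv (𝓡 n) g.scalarCurvature x).toLinearMap
        (mvfderiv (𝓡 n) f x).toLinearMap * Real.exp (-f x / τ) +
      g.scalarCurvature x * Real.exp (-f x / τ) -
      2 * (g.normSq x (g.ricci x) * Real.exp (-f x / τ))) g.riemVolume := iA.sub iC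
  have huΔ : Integrable (fun x ↦ Real.exp (-f x / τ) * g.dalembertian g.scalarCurvature x)
      g.riemVolume :=
    iB.congr (Eventually.of_forall fun x ↦ (hpt x).symm)
  -- pointwise `g⁻¹(d e^{-f/τ}, dR) = -τ⁻¹ g⁻¹(dR, df) e^{-f/τ}`
  have hduw_pt : ∀ x, g.innerDual x (mvfderiv (𝓡 n) (fun y ↦ Real.exp (-f y / τ)) x).toLinearMap
      (mvfderiv (𝓡 n) g.scalarCurvature x).toLinearMap =
      -τ⁻¹ * (g.innerDual x (mvfderiv (𝓡 n) g.scalarCurvature x).toLinearMap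
        (mvfderiv (𝓡 n) f x).toLinearMap * Real.exp (-f x / τ)) := fun x ↦ by
    rw [g.innerDual_comm x,
      weightedIdentity_innerDual_mvfderiv_expNegDiv τ (hf.mdifferentiableAt (by norm_num))]
    ring
  have hduw : Integrable (fun x ↦ g.innerDual x
      (mvfderiv (𝓡 n) (fun y ↦ Real.exp (-f y / τ)) x).toLinearMap
      (mvfderiv (𝓡 n) g.scalarCurvature x).toLinearMap) g.riemVolume :=
    (hX.const_mul (-τ⁻¹)).congr (Eventually.of_forall fun x ↦ (hduw_pt x).symm)
  -- pointwise `e^{-f/τ} g⁻¹(df, dR) = g⁻¹(dR, df) e^{-f/τ}`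
  have hcross_pt : ∀ x, Real.exp (-f x / τ) * g.innerDual x (mvfderiv (𝓡 n) f x).toLinearMap
      (mvfderiv (𝓡 n) g.scalarCurvature x).toLinearMap =
      g.innerDual x (mvfderiv (𝓡 n) g.scalarCurvature x).toLinearMap
        (mvfderiv (𝓡 n) f x).toLinearMap * Real.exp (-f x / τ) := fun x ↦ by
    rw [g.innerDual_comm x, mul_comm]
  have hcross : Integrable (fun x ↦ Real.exp (-f x / τ) * g.innerDual x
      (mvfderiv (𝓡 n) f x).toLinearMap
      (mvfderiv (𝓡 n) g.scalarCurvature x).toLinearMap) g.riemVolume :=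
    hX.congr (Eventually.of_forall fun x ↦ (hcross_pt x).symm)
  have hG :=
    CarrilloNi2009_shrinkerLSI.integral_mul_dalembertian_eq_neg_integral_innerDual_of_proper hg hf
      hprop hv1 hS2 huΔ hduw hcross
  -- evaluate both sides
  have hI1 : ∫ x, Real.exp (-f x / τ) * g.dalembertian g.scalarCurvature x ∂g.riemVolume =
      (∫ x, g.innerDual x (mvfderiv (𝓡 n) g.scalarCurvature x).toLinearMap
        (mvfderiv (𝓡 n) f x).toLinearMap * Real.exp (-f x / τ) ∂g.riemVolume) +
      (∫ x, g.scalarCurvature x * Real.exp (-f x / τ) ∂g.riemVolume) -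
      2 * (∫ x, g.normSq x (g.ricci x) * Real.exp (-f x / τ) ∂g.riemVolume) := by
    simp_rw [hpt]
    rw [integral_sub iA iC, integral_add hX iR, integral_const_mul]
  have hI2 : ∫ x, g.innerDual x (mvfderiv (𝓡 n) (fun y ↦ Real.exp (-f y / τ)) x).toLinearMap
      (mvfderiv (𝓡 n) g.scalarCurvature x).toLinearMap ∂g.riemVolume =
      -τ⁻¹ * ∫ x, g.innerDual x (mvfderiv (𝓡 n) g.scalarCurvature x).toLinearMap
        (mvfderiv (𝓡 n) f x).toLinearMap * Real.exp (-f x / τ) ∂g.riemVolume := by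
    simp_rw [hduw_pt]
    rw [integral_const_mul]
  rw [hI1, hI2] at hG
  linear_combination hG

end ProperGreen

/-! ## The Ricci moment identity (n = 4) -/

section Integrated

variable {M : Type} [TopologicalSpace M] [T2Space M] [SecondCountableTopology M]
  [ChartedSpace (EuclideanSpace ℝ (Fin 4)) M] [IsManifold (𝓡 4) ∞ M] [ConnectedSpace M]
  [T3Space M] [MeasurableSpace M] [BorelSpace M]

/-- **The Ricci moment identity at scale `τ`, `n = 4`, over `g.riemVolume`**: on a complete connected
normalised 4-d gradient shrinker, for every `τ > 0`, GIVEN that `|Ric|² e^{-f/τ}` and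
`g⁻¹(dR, df) e^{-f/τ}` are integrable,
`2 ∫ |Ric|² e^{-f/τ} = ∫ R e^{-f/τ} + (τ − 1) [τ⁻² ∫ (f R − R²) e^{-f/τ} − τ⁻¹ ∫ (2R − R²) e^{-f/τ}]`:
with `X = ∫ g⁻¹(dR, df) e^{-f/τ}` and `W = ∫ R Δ(e^{-f/τ})`, Green (A) (`ricciMoment_greenA`) is
`W = τ⁻¹ X` and Green (B) (`ricciMoment_greenB`) is `X + ∫ R e^{-f/τ} − 2 ∫ |Ric|² e^{-f/τ} = τ⁻¹ X`,
so `2 ∫ |Ric|² e^{-f/τ} = ∫ R e^{-f/τ} + (τ − 1) W`; properness of `f` and `R ≥ 0` by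
`NoncompactShrinkerGapCarrilloNiClauses.scalarCurvature_nonneg_and_isCompact_sublevel`. -/
theorem ricciMoment_riemVolume
    (g : PseudoRiemannianMetric (𝓡 4) ∞ (EuclideanSpace ℝ (Fin 4)) (TangentSpace (𝓡 4) : M → Type _))
    [g.HasLeviCivita] (f : M → ℝ) (hg : g.IsRiemannian)
    (hc : ∀ (x : M) (r : NNReal), IsCompact {y : M | g.edist hg x y ≤ r})
    (hf : ContMDiff (𝓡 4) 𝓘(ℝ, ℝ) ∞ f)
    (hsol : ∀ (x : M) (X Y : TangentSpace (𝓡 4) x),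
      g.ricci x X Y + g.hessian f x X Y = (1 / 2 : ℝ) * g.val x X Y)
    (hnorm : ∀ x : M, g.scalarCurvature x + g.gradSq f x = f x) {τ : ℝ} (hτ : 0 < τ)
    (hRic : Integrable (fun x ↦ g.normSq x (g.ricci x) * Real.exp (-f x / τ)) g.riemVolume)
    (hX : Integrable (fun x ↦ g.innerDual x (mvfderiv (𝓡 4) g.scalarCurvature x).toLinearMap
      (mvfderiv (𝓡 4) f x).toLinearMap * Real.exp (-f x / τ)) g.riemVolume) :
    2 * ∫ x, g.normSq x (g.ricci x) * Real.exp (-f x / τ) ∂g.riemVolume =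
      (∫ x, g.scalarCurvature x * Real.exp (-f x / τ) ∂g.riemVolume) +
        (τ - 1) * ((τ ^ 2)⁻¹ *
          ((∫ x, f x * g.scalarCurvature x * Real.exp (-f x / τ) ∂g.riemVolume) -
            (∫ x, g.scalarCurvature x ^ 2 * Real.exp (-f x / τ) ∂g.riemVolume)) -
          τ⁻¹ * (2 * (∫ x, g.scalarCurvature x * Real.exp (-f x / τ) ∂g.riemVolume) -
            (∫ x, g.scalarCurvature x ^ 2 * Real.exp (-f x / τ) ∂g.riemVolume))) := by
  obtain ⟨hR0, -, hprop⟩ :=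
    NoncompactShrinkerGapCarrilloNiClauses.scalarCurvature_nonneg_and_isCompact_sublevel g f hg hc hf
      hsol hnorm
  have hA := ricciMoment_greenA hg hf hsol hnorm hprop hR0 hτ hX
  have hB := ricciMoment_greenB hg hf hsol hnorm hprop hR0 hτ hRic hX
  have hτinv : τ * τ⁻¹ = 1 := mul_inv_cancel₀ hτ.ne'
  simp only [Nat.cast_ofNat] at hA
  linear_combination -hB + (1 - τ) * hA -
    (∫ x, g.innerDual x (mvfderiv (𝓡 4) g.scalarCurvature x).toLinearMap
      (mvfderiv (𝓡 4) f x).toLinearMap * Real.exp (-f x / τ) ∂g.riemVolume) * hτinv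

end Integrated

/-! ## The registered helper -/

/-- **Helper `helper_ricciMomentIdentity` of line `Sketch`** (the Ricci moment identity at every
scale, `n = 4`): on every complete connected normalised 4-d gradient shrinking Ricci soliton and for
every `τ > 0`, GIVEN that `|Ric|² e^{-f/τ}` and `g⁻¹(dR, df) e^{-f/τ}` are integrable,
`2 ∫ |Ric|² e^{-f/τ} dV = ∫ R e^{-f/τ} dV
  + (τ − 1) [τ⁻² (∫ f R e^{-f/τ} dV − ∫ R² e^{-f/τ} dV) − τ⁻¹ (2 ∫ R e^{-f/τ} dV − ∫ R² e^{-f/τ} dV)]`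
(`dV` the Riemannian measure of `g.toContMDiffRiemannianMetric hg`, to which `g.riemVolume` unfolds
by `riemVolume_eq`); at `τ = 1` this is the classical `2 ∫ |Ric|² e^{-f} = ∫ R e^{-f}`:
`ricciMoment_riemVolume`. -/
theorem helper_ricciMomentIdentity : ∀ (M : Type) [TopologicalSpace M] [T2Space M] [SecondCountableTopology M] [ChartedSpace (EuclideanSpace ℝ (Fin 4)) M] [IsManifold (𝓡 4) ∞ M] [ConnectedSpace M] [T3Space M] [MeasurableSpace M] [BorelSpace M] (g : Literature.Geometry.Lorentzian.PseudoRiemannianMetric (𝓡 4) ∞ (EuclideanSpace ℝ (Fin 4)) (TangentSpace (𝓡 4) : M → Type _)) [g.HasLeviCivita] (f : M → ℝ) (hg : g.IsRiemannian), (∀ (x : M) (r : NNReal), IsCompact {y : M | g.edist hg x y ≤ r}) → ContMDiff (𝓡 4) 𝓘(ℝ, ℝ) ∞ f → (∀ (x : M) (X Y : TangentSpace (𝓡 4) x), g.ricci x X Y + g.hessian f x X Y = (1 / 2 : ℝ) * g.val x X Y) → (∀ x : M, g.scalarCurvature x + g.gradSq f x = f x) → ∀ τ : ℝ, 0 < τ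 → MeasureTheory.Integrable (fun x ↦ g.normSq x (g.ricci x) * Real.exp (-f x / τ)) (Literature.Geometry.Lorentzian.riemannianMeasure (g.toContMDiffRiemannianMetric hg)) → MeasureTheory.Integrable (fun x ↦ g.innerDual x (mvfderiv (𝓡 4) g.scalarCurvature x).toLinearMap (mvfderiv (𝓡 4) f x).toLinearMap * Real.exp (-f x / τ)) (Literature.Geometry.Lorentzian.riemannianMeasure (g.toContMDiffRiemannianMetric hg)) → 2 * ∫ x, g.normSq x (g.ricci x) * Real.exp (-f x / τ) ∂(Literature.Geometry.Lorentzian.riemannianMeasure (g.toContMDiffRiemannianMetric hg)) = (∫ x, g.scalarCurvature x * Real.exp (-f x / τ) ∂(Literature.Geometry.Lorentzian.riemannianMeasure (g.toContMDiffRiemannianMetric hg))) + (τ - 1) * ((τ ^ 2)⁻¹ * ((∫ x, f x * g.scalarCurvature x * Real.exp (-f x / τ) ∂(Literature.Geometry.Lorentzian.riemannianMeasure (g.toContMDiffRiemannianMetric hg))) - (∫ x, g.scalarCurvature x ^ 2 * Real.exp (-f x / τ) ∂(Literature.Geometry.Lorentzian.riemannianMeasure (g.toContMDiffRiemannianMetric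 hg)))) - τ⁻¹ * (2 * (∫ x, g.scalarCurvature x * Real.exp (-f x / τ) ∂(Literature.Geometry.Lorentzian.riemannianMeasure (g.toContMDiffRiemannianMetric hg))) - (∫ x, g.scalarCurvature x ^ 2 * Real.exp (-f x / τ) ∂(Literature.Geometry.Lorentzian.riemannianMeasure (g.toContMDiffRiemannianMetric hg))))) := by
  intro M _ _ _ _ _ _ _ _ _ g _ f hg hc hf hsol hnorm τ hτ hRic hX
  rw [← PseudoRiemannianMetric.riemVolume_eq hg] at hRic hX ⊢
  exact ricciMoment_riemVolume g f hg hc hf hsol hnorm hτ hRic hX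

end Summit.SmoothPoincare4.SmoothPoincare4.Theorems.ConicalGapSketch

end
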